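/-
Copyright (c) 2026 the pub-hodgecm-mathlib formalisation cell (harness21).  Prover seat hodgecm-mathlib-F0P3a-p08 (g19), 2026-09-02.  Road «S3-tree»∕«S3-ram» (LEAD F0P3a-plan (g12)
T11-41∕T11-52; owner p06 (g15)), row (e2)(b) «P-2-ram»: R2²-ram «THE FREE ROW, TYPE (2), AT A TAMELY RAMIFIED PLACE» — the ONE-PLACE row value, ramified twin of ★ A-p19 (g26)
`DepthZeroKappaTransferTypeTwoRowTwoPlace` (inert).  Consumer: F0P3a-p07 (g13)'s (T2) G-side, rows `bd` and `reg` (00:10:46Z «YES»).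
-/
import Literature.NumberTheory.Rogawski1990.TypeTwoUnitIndexAtRamifiedCMPlace        -- ★ p847342 (this seat) FILE 1: (D5)-ram at the CM place
import Literature.NumberTheory.LocalFields.RamifiedPlaceSkewDiscriminantRoot         -- (this seat) FILE 2a: (D2-α)-ram skew square root + `mul_map_mul_eq_one_of_skew_sqrt`
import Literature.NumberTheory.NumberFields.UnramifiedQuadraticDictionary           -- ★ p847266 A-p19 (g27) (D2-β)-ram part L: (L1′) `exists_sqrt_and_coord_of_unit`, (L2′) `exists_involutions_of_unit`, `ramificationIdx'_eq_one_of_unit`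
import Literature.NumberTheory.Automorphic.CyclicSelfDualLatticeTorsorRamified        -- ★ p847213 A-p19 (g27) [T2-a]-ram: `ncard_setOf_selfDual_cyclic_eq_relIndex_of_ramified` (brings ★ [T2-a] `exists_units_of_mem`)
import Literature.NumberTheory.Automorphic.TypeTwoCommutantBridge                    -- ★ p846662 (D3): `exists_algHom_prod`, `exists_aeval_prod_eq`, `hstar_of_algHom_prod`, `mem_adjoin_integer_iff_exists_mem_map`, `relIndex_units_map_prod_eq`
import Literature.NumberTheory.NumberFields.QuadraticUnramifiedAtUnitPlace            -- ★ Q3-unit: `exists_ringOfIntegers_not_mem_isSquare_inv_mul_not_isSquare`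
import Literature.NumberTheory.NumberFields.QuadraticCompletionAtNonsplitPlace        -- ★ QM: `numberField_adjoinRoot`, `isQuadraticExtension_adjoinRoot`, `exists_algEquiv_root_eq_neg`, `root_X_sq_sub_C_sq`, `root_X_sq_sub_C_ne_zero`, `not_isSquare_of_not_isSquare_algebraMap`
import Literature.NumberTheory.Automorphic.ValuedFieldValuativeRelBridge              -- ★ `v_eq_iff_valuation_eq`, `v_le_one_iff_mem_integer`, …
import HarnessLib

/-!
# The depth-zero κ-transfer, type (2), TAMELY RAMIFIED place: ROW 2 at ONE PLACE — the number of self-dual `τ`-cyclic lattices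

Topic `NumberTheory/Rogawski1990`; namespace `Literature.NumberTheory.Rogawski1990`.  THEOREMS ONLY (no definition, no instance, no notation, no named fact, no `sorry`); kernel lane
`--supports stmt-HodgeConjecture-24833`.  Road «S3-tree», seeding wave «S3-ram» (tame-ramified non-split `v ∤ 2`), row (e2)(b) «P-2-ram» — the R2²-ram FREE ROW at one place: the
ramified twin of ★ `DepthZeroKappaTransferTypeTwoRowTwoPlace.ncard_selfDual_cyclic_typeTwo_eq_ite(_of_model)`.  Consumer: the `bd` (and `reg = bd ∕ q`) rows of the (T2) G-side
(F0P3a-p07 (g13) ASSEMBLY LEDGER v1.3 `stub_T2G_bd`∕`stub_T2G_reg`; A-p12 (g23∕g24) ★ p847306 `typeTwoRow_ram_of_typeTwoGSide_of_massRatio`).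
HONEST LABEL: HC_CM is proved only modulo the 2 remaining named inputs (hLiu418 24832, h413 24833) until rung 0 closes; unconditional local algebra, count-neutral.

THE MATHEMATICS (Rogawski §4.9, proof of Lemma 4.9.3 for a type-(2) class; Kottwitz §3; Jacobowitz §5, §7).  `E = L_w` the CM completion at a place `w ∣ v ∤ 2` RAMIFIED in `L`
(`σ = σ_w`), `J ∈ GL₃(𝒪_w)` `σ`-hermitian, `τ ∈ U(σ,J)(E)` deep of type (2): `χ_τ = (X − u)(X² − tX + D)`, `σu·u = 1`, `DσD = 1`, `σt = tσD`, `u ≡ 1`, `t ≡ 2`,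
`ord_E(u² − tu + D) = n`, and — the ramified feature — the discriminant `t² − 4D` has EVEN order `2N` and is maximally non-square, so that the eigen-field `K = E(√(t² − 4D)) = E(√ε₀)`
is the UNRAMIFIED quadratic extension (`ε₀ ∈ L⁺_v` a residue non-square, (D2-α)-ram `exists_skew_sqrt_discriminant_of_ramified`: `t² − 4D = y²·ι ε₀`, `|y| = exp(−N)`,
`σy = (−1)^N·y·σD`).  The self-dual `τ`-CYCLIC lattices `S(τ) = {Λ = Λ(g) self-dual : Λ = ⊕ 𝒪 τ^k w}` form, when non-empty, a torsor under `C ∕ R^×` (★ [T2-a]-ram,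
`R = 𝒪[τ] ≅ 𝒪_E[(u, λ)] ≤ E × K`, `C = {c : cc⋆ ∈ R^×}`), and `[C : R^×]` is ★ (D5)-ram: `2·q^{(N+n−1)∕2}` for torus TYPE A (`N` odd: the adjoint involution fixes `θ = √ε₀`) and
`(q+1)·q^{(N+n−2)∕2}` for TYPE B (`N` even: it negates `θ`) — the type bit is READ OFF the parity of `N` ((D2-α)-ram §2: `λ·s̃λ = 1` for `s̃θ = (−1)^{N+1}θ`), and `n` is even
(`u² − tu + D = N_{K∕E}(u − λ)` with `K ∕ E` unramified).  Hence
**`#S(τ) = 2·q^{(N+n−1)∕2}` (`N` odd) ∕ `(q+1)·q^{(N+n−2)∕2}` (`N` even) if `S(τ) ≠ ∅, and `0` otherwise** — `ncard_selfDual_cyclic_typeTwo_ram_eq_of_model` (given a global model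
`M = L(√m₀)` of `K`) and `ncard_selfDual_cyclic_typeTwo_ram_eq` (the model realised by ★ Q3-unit).  The non-emptiness condition is LITERALLY the left side of A-p19 (g27)'s
LAW AT THE PLACE (`RationalGoodVectorRamifiedPlace.exists_selfDual_cyclic_iff_rational_norm_type{A,B}_of_ramified`), which rewrites it into the rational-norm class condition.

References: [Rogawski1990] J. D. Rogawski, *Automorphic Representations of Unitary Groups in Three Variables* (1990), §4.9 Lemma 4.9.3 p. 56, Prop. 4.9.1 (b) p. 55;
[Kottwitz1986] R. E. Kottwitz, *Base change for unit elements of Hecke algebras*, Compositio Math. 60 (1986), §3; [Jacobowitz1962] R. Jacobowitz, *Hermitian forms over local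
fields*, Amer. J. Math. 84 (1962), §5, §7; [SerreLocalFields1979] J.-P. Serre, *Local Fields*, GTM 67 (1979), Ch. V §2 Prop. 3, Ch. X §1.
-/

set_option autoImplicit false

noncomputable section

open NumberField IsDedekindDomain Matrix Polynomial Finset ValuativeRel
open scoped MatrixGroups WithZero ValuativeRel

namespace Literature.NumberTheory.Rogawski1990

open Literature.NumberTheory.Automorphic Literature.NumberTheory.Automorphic.UnitaryGroup Literature.NumberTheory.NumberFields Literature.NumberTheory.LocalFields

variable (L : Type) [Field L] [NumberField L] [IsCMField L] {v : HeightOneSpectrum (𝓞 ↥(maximalRealSubfield L))}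

set_option synthInstance.maxHeartbeats 200000 in
set_option maxHeartbeats 3200000 in
/-- **ROW 2 AT ONE RAMIFIED PLACE, GIVEN A GLOBAL MODEL OF THE EIGEN-FIELD.**  For a deep type-(2) unitary `τ` over the CM completion `E = L_w` (`w ∣ v` RAMIFIED in `L`,
`|2|_w = 1`, `J ∈ GL₃(𝒪_w)` `σ_w`-hermitian; `χ_τ = (X − u)(X² − tX + D)` integral, `σu·u = 1`, `DσD = 1`, `σt = tσD`, `u ≡ 1`, `t ≡ 2`, `ord(u² − tu + D) = n`,
`4D = t² − y²·ι ε₀` with `ε₀ ∈ L⁺_v` a residue non-square, `|y| = exp(−N)`, `σy = (−1)^N·y·σD`, `1 ≤ N`; cyclic vector `w₀`), and a quadratic number field `M ⊃ L` whose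
completion at `w₁ ∣ w` is `L_w(√ε₀)` (`c₁ δ₁ = −δ₁`, `m₀ = δ₁²`, `m₀ ∉ 𝔭_w`, `(ι ε₀)⁻¹ m₀ ∈ (L_w^×)²`): the number of self-dual `τ`-cyclic lattices is `2·q^{(N+n−1)∕2}` (`N` odd)
resp. `(q+1)·q^{(N+n−2)∕2}` (`N` even) if there is one, and `0` otherwise (`q = N(v)`).
[cite: Rogawski1990, §4.9 Lemma 4.9.3 p. 56, Prop. 4.9.1 (b) p. 55] [cite: Kottwitz1986, §3] [cite: Jacobowitz1962, §5, §7] -/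
theorem ncard_selfDual_cyclic_typeTwo_ram_eq_of_model (w : PlacesOver L v) (hw : IsCMField.complexConj L • w.1 = w.1)
    (he : v.asIdeal.ramificationIdx' w.1.asIdeal ≠ 1) (hv2 : Valued.v (2 : w.1.adicCompletion L) = 1)
    (J : GL (Fin 3) (w.1.adicCompletion L)) (hJ : J ∈ glInt 3 (w.1.adicCompletion L))
    (hJh : ((J : Matrix (Fin 3) (Fin 3) (w.1.adicCompletion L)).map (galAdicCompletionMap (L := L) (IsCMField.complexConj L) hw))ᵀ = J)
    (τ : Matrix (Fin 3) (Fin 3) (w.1.adicCompletion L))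
    (hτU : (τ.map (galAdicCompletionMap (L := L) (IsCMField.complexConj L) hw))ᵀ * (J : Matrix (Fin 3) (Fin 3) (w.1.adicCompletion L)) * τ = J)
    (hint : ∀ i, τ.charpoly.coeff i ∈ 𝒪[w.1.adicCompletion L])
    {u t D : w.1.adicCompletion L} (hχ : τ.charpoly = (X - C u) * (X ^ 2 - C t * X + C D))
    (hσu : galAdicCompletionMap (L := L) (IsCMField.complexConj L) hw u * u = 1)
    (hσD : D * galAdicCompletionMap (L := L) (IsCMField.complexConj L) hw D = 1)
    (hσt : galAdicCompletionMap (L := L) (IsCMField.complexConj L) hw t = t * galAdicCompletionMap (L := L) (IsCMField.complexConj L) hw D)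
    (hu1 : Valued.v (u - 1) < 1) (ht2 : Valued.v (t - 2) < 1)
    {n N : ℕ} (hn : Valued.v (u * u - t * u + D) = WithZero.exp (-(n : ℤ))) (hN1 : 1 ≤ N)
    {w₀ : Fin 3 → w.1.adicCompletion L} (hK : IsUnit (Matrix.of fun i j : Fin 3 => ((τ ^ (j : ℕ)) *ᵥ w₀) i).det)
    {y : w.1.adicCompletion L} {ε₀ : v.adicCompletion ↥(maximalRealSubfield L)}
    (hns : ∀ b : w.1.adicCompletion L, Valued.v b ≤ 1 → Valued.v (b * b - toPlace v w ε₀) = 1)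
    (hD : 4 * D = t * t - y * y * toPlace v w ε₀)
    (hσy : galAdicCompletionMap (L := L) (IsCMField.complexConj L) hw y =
      (-1) ^ N * (y * galAdicCompletionMap (L := L) (IsCMField.complexConj L) hw D))
    (hN : Valued.v y = WithZero.exp (-(N : ℤ)))
    {M : Type} [Field M] [NumberField M] [Algebra L M] [Algebra.IsQuadraticExtension L M] (c₁ : M ≃ₐ[L] M) {δ₁ : M} (hcδ : c₁ δ₁ = -δ₁) (hδ₁ : δ₁ ≠ 0)
    (m₀ : 𝓞 L) (hm : algebraMap L M m₀ = δ₁ ^ 2) (hm₀ : m₀ ∉ w.1.asIdeal)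
    (hdm : IsSquare ((toPlace v w ε₀)⁻¹ * (((m₀ : L)) : w.1.adicCompletion L))) (w₁ : PlacesOver M w.1) :
    ((∃ wv : Fin 3 → w.1.adicCompletion L, ∃ g ∈ unitaryGroupOfForm (galAdicCompletionMap (L := L) (IsCMField.complexConj L) hw) (J : Matrix (Fin 3) (Fin 3) (w.1.adicCompletion L)),
        Submodule.span 𝒪[w.1.adicCompletion L] (Set.range fun k : Fin 3 => (τ ^ (k : ℕ)) *ᵥ wv) =
          Submodule.span 𝒪[w.1.adicCompletion L] (Set.range ((g : Matrix (Fin 3) (Fin 3) (w.1.adicCompletion L)))ᵀ)) →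
      {Λ : Submodule 𝒪[w.1.adicCompletion L] (Fin 3 → w.1.adicCompletion L) |
          (∃ g ∈ unitaryGroupOfForm (galAdicCompletionMap (L := L) (IsCMField.complexConj L) hw) (J : Matrix (Fin 3) (Fin 3) (w.1.adicCompletion L)),
            Λ = Submodule.span 𝒪[w.1.adicCompletion L] (Set.range ((g : Matrix (Fin 3) (Fin 3) (w.1.adicCompletion L)))ᵀ)) ∧
          ∃ wv : Fin 3 → w.1.adicCompletion L, Λ = Submodule.span 𝒪[w.1.adicCompletion L] (Set.range fun j : Fin 3 => (τ ^ (j : ℕ)) *ᵥ wv)}.ncard =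
        if Odd N then 2 * Ideal.absNorm v.asIdeal ^ ((N + n - 1) / 2) else (Ideal.absNorm v.asIdeal + 1) * Ideal.absNorm v.asIdeal ^ ((N + n - 2) / 2)) ∧
    ((¬ ∃ wv : Fin 3 → w.1.adicCompletion L, ∃ g ∈ unitaryGroupOfForm (galAdicCompletionMap (L := L) (IsCMField.complexConj L) hw) (J : Matrix (Fin 3) (Fin 3) (w.1.adicCompletion L)),
        Submodule.span 𝒪[w.1.adicCompletion L] (Set.range fun k : Fin 3 => (τ ^ (k : ℕ)) *ᵥ wv) =
          Submodule.span 𝒪[w.1.adicCompletion L] (Set.range ((g : Matrix (Fin 3) (Fin 3) (w.1.adicCompletion L)))ᵀ)) →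
      {Λ : Submodule 𝒪[w.1.adicCompletion L] (Fin 3 → w.1.adicCompletion L) |
          (∃ g ∈ unitaryGroupOfForm (galAdicCompletionMap (L := L) (IsCMField.complexConj L) hw) (J : Matrix (Fin 3) (Fin 3) (w.1.adicCompletion L)),
            Λ = Submodule.span 𝒪[w.1.adicCompletion L] (Set.range ((g : Matrix (Fin 3) (Fin 3) (w.1.adicCompletion L)))ᵀ)) ∧
          ∃ wv : Fin 3 → w.1.adicCompletion L, Λ = Submodule.span 𝒪[w.1.adicCompletion L] (Set.range fun j : Fin 3 => (τ ^ (j : ℕ)) *ᵥ wv)}.ncard = 0) := by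
  classical
  haveI : Algebra.IsQuadraticExtension ↥(maximalRealSubfield L) L := IsCMField.isQuadraticExtension L
  have hc1 : IsCMField.complexConj L ≠ 1 := IsCMField.complexConj_ne_one L
  -- tokens at `w`
  set σw := galAdicCompletionMap (L := L) (IsCMField.complexConj L) hw with hσw_def
  have hσσ := galAdicCompletionMap_galAdicCompletionMap_of_smul_eq (IsCMField.complexConj L) w hc1 hw
  have hσO := mem_integer_galAdicCompletionMap (IsCMField.complexConj L) v w hw
  have hσv := valuation_galAdicCompletionMap_eq (IsCMField.complexConj L) v w hw
  have hσv' : ∀ x, Valued.v (σw x) = Valued.v x := fun x => (v_eq_iff_valuation_eq _ _).2 (hσv x)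
  have e2 : ((2 : 𝒪[w.1.adicCompletion L]) : w.1.adicCompletion L) = 2 := map_ofNat (𝒪[w.1.adicCompletion L]).subtype 2
  have h20 : (2 : w.1.adicCompletion L) ≠ 0 := fun h => by rw [h, map_zero] at hv2; exact zero_ne_one hv2
  have h2 : IsUnit (2 : 𝒪[w.1.adicCompletion L]) := by
    rw [Valuation.Integers.isUnit_iff_valuation_eq_one (Valuation.integer.integers (ValuativeRel.valuation (w.1.adicCompletion L))), map_ofNat]
    exact (v_eq_one_iff_valuation_eq_one _).1 hv2
  -- `d = ι ε₀`: a `σ_w`-fixed residue non-square unit of `L_w`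
  have hdv : Valued.v (toPlace v w ε₀) = 1 := by
    have h := hns 0 (by rw [map_zero]; exact zero_le_one)
    rwa [zero_mul, zero_sub, Valuation.map_neg] at h
  have hd0 : toPlace v w ε₀ ≠ 0 := fun h0 => by rw [h0, map_zero] at hdv; exact zero_ne_one hdv
  have hσd : σw (toPlace v w ε₀) = toPlace v w ε₀ := galAdicCompletionMap_toPlace (IsCMField.complexConj L) w w hw ε₀
  have hdnsq : ¬ IsSquare (toPlace v w ε₀) := by
    rintro ⟨r, hr⟩
    have hr1 : Valued.v r ≤ 1 := by
      by_contra hlt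
      rw [not_le] at hlt
      have h1 : (1 : WithZero (Multiplicative ℤ)) < Valued.v (toPlace v w ε₀) := by
        rw [hr, map_mul]; exact one_lt_mul'' hlt hlt
      exact absurd hdv h1.ne'
    have h := hns r hr1
    rw [← hr, sub_self, map_zero] at h
    exact zero_ne_one h
  -- elementary consequences of the eigen-data
  have hy0 : y ≠ 0 := fun h0 => by rw [h0, map_zero] at hN; exact WithZero.zero_ne_coe hN
  have hu0 : u ≠ 0 := fun h0 => by rw [h0, mul_zero] at hσu; exact zero_ne_one hσu
  have hD0 : D ≠ 0 := fun h0 => by rw [h0, zero_mul] at hσD; exact zero_ne_one hσD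
  have hDv : Valued.v D = 1 := by
    have h := congrArg Valued.v hσD
    rw [map_mul, hσv', map_one] at h
    rcases eq_or_ne (Valued.v D) 0 with h0 | h0
    · rw [h0, zero_mul] at h; exact absurd h zero_ne_one
    · rw [← WithZero.exp_log h0, ← WithZero.exp_add, ← WithZero.exp_zero, WithZero.exp_inj] at h
      rw [← WithZero.exp_log h0, ← WithZero.exp_zero, WithZero.exp_inj]; omega
  have hχu : u * u - t * u + D ≠ 0 := fun h0 => by rw [h0, map_zero] at hn; exact WithZero.zero_ne_coe hn
  have hdisc : t ^ 2 - 4 * D = y * y * toPlace v w ε₀ := by linear_combination -hD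
  have hirr : ∀ x : w.1.adicCompletion L, x * x - t * x + D ≠ 0 := by
    intro x hx
    refine hdnsq ⟨(2 * x - t) / y, ?_⟩
    field_simp
    linear_combination hD - 4 * hx
  set e₂ : w.1.adicCompletion L := 2⁻¹ with he₂
  have h2e : e₂ * 2 = 1 := inv_mul_cancel₀ h20
  have hτu : IsUnit τ.det := by
    rw [isUnit_iff_ne_zero, Matrix.det_eq_sign_charpoly_coeff, Polynomial.coeff_zero_eq_eval_zero, hχ]
    simp only [eval_mul, eval_sub, eval_add, eval_X, eval_C, eval_pow, Fintype.card_fin]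
    have : (-1 : w.1.adicCompletion L) ^ 3 * ((0 - u) * (0 ^ 2 - t * 0 + D)) = u * D := by ring
    rw [this]
    exact mul_ne_zero hu0 hD0
  have hfτ : aeval τ (C 1 * X ^ 3 + C (-(t + u)) * X ^ 2 + C (D + t * u) * X + C (-(u * D))) = 0 := by
    have h := Matrix.aeval_self_charpoly τ
    rw [hχ] at h
    have hf : (C 1 * X ^ 3 + C (-(t + u)) * X ^ 2 + C (D + t * u) * X + C (-(u * D)) : (w.1.adicCompletion L)[X]) =
        (X - C u) * (X ^ 2 - C t * X + C D) := by
      simp only [map_one, map_neg, map_add, map_mul, one_mul]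
      ring
    rw [hf]; exact h
  -- `n` is at least `1`: `u² − tu + D = (u−1)² + (2−t)u + (D−1)` with `4(D−1) = (t−2)(t+2) − y²·ι ε₀`
  have huv : Valued.v u ≤ 1 := by
    have h := Valued.v.map_add_le hu1.le (le_of_eq (Valued.v.map_one))
    rwa [sub_add_cancel] at h
  have htv : Valued.v t ≤ 1 := by
    have h := Valued.v.map_add_le ht2.le hv2.le
    rwa [sub_add_cancel] at h
  have hyv1 : Valued.v y < 1 := by
    rw [hN, ← WithZero.exp_zero]; exact WithZero.exp_lt_exp.2 (by omega)
  have h4v : Valued.v (4 : w.1.adicCompletion L) = 1 := by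
    rw [show (4 : w.1.adicCompletion L) = 2 * 2 by norm_num, map_mul, hv2, mul_one]
  have hD1 : Valued.v (D - 1) < 1 := by
    have h4 : Valued.v (4 * (D - 1)) < 1 := by
      rw [show 4 * (D - 1) = (t - 2) * (t + 2) + -(y * y * toPlace v w ε₀) by linear_combination hD]
      refine (Valued.v.map_add _ _).trans_lt (max_lt ?_ ?_)
      · rw [map_mul]
        have ht2' : Valued.v (t + 2) ≤ 1 := (Valued.v.map_add _ _).trans (max_le htv hv2.le)
        exact mul_lt_one_of_lt_of_le ht2 ht2'
      · rw [Valuation.map_neg, map_mul, map_mul, hdv, mul_one]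
        exact mul_lt_one_of_lt_of_le hyv1 hyv1.le
    rwa [map_mul, h4v, one_mul] at h4
  have hn1 : 1 ≤ n := by
    by_contra h0
    have hn0 : n = 0 := by omega
    rw [hn0, Nat.cast_zero, neg_zero, WithZero.exp_zero] at hn
    have hlt : Valued.v (u * u - t * u + D) < 1 := by
      rw [show u * u - t * u + D = (u - 1) * (u - 1) + ((2 - t) * u + (D - 1)) by ring]
      refine (Valued.v.map_add _ _).trans_lt (max_lt ?_ ((Valued.v.map_add _ _).trans_lt (max_lt ?_ hD1)))
      · rw [map_mul]; exact mul_lt_one_of_lt_of_le hu1 hu1.le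
      · rw [map_mul, ← Valuation.map_neg, neg_sub]; exact mul_lt_one_of_lt_of_le ht2 huv
    exact absurd hn hlt.ne
  -- ★ (D2-β)-ram part L: the unramified eigen-field package at `w₁`
  obtain ⟨θ, hθ, hθv, hcoord, hintK, hval⟩ := exists_sqrt_and_coord_of_unit M w.1 c₁ hcδ hδ₁ m₀ hm hm₀ hdv hdnsq hdm hv2 w₁
  obtain ⟨s', ι', ⟨hs'ι, hs'θ, hs's', hs'O, hs'v⟩, ⟨hι'ι, hι'θ, hι'ι', hι'O, hι'v⟩, hcomm⟩ :=
    exists_involutions_of_unit M w.1 c₁ hcδ hδ₁ m₀ hm hm₀ hdv hdnsq hdm hv2 w₁ σw hσσ hσd hσO hσv' hθ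
  have he1 : (w.1).asIdeal.ramificationIdx' w₁.1.asIdeal = 1 := ramificationIdx'_eq_one_of_unit M w.1 c₁ hcδ hδ₁ m₀ hm hm₀ hdnsq hdm hv2 w₁
  have hjv : ∀ x, Valued.v (toPlace w.1 w₁ x) = Valued.v x := valued_toPlace_of_ramificationIdx'_eq_one M w.1 w₁ he1
  -- the adjoint involution on `K`: `s̃ θ = (−1)^{N+1} θ` (type A for `N` odd, type B for `N` even)
  obtain ⟨s₁, hs₁ι, hs₁θ, hs₁s₁, hs₁O, hs₁v⟩ : ∃ s₁ : w₁.1.adicCompletion M →+* w₁.1.adicCompletion M,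
      (∀ x, s₁ (toPlace w.1 w₁ x) = toPlace w.1 w₁ (σw x)) ∧ s₁ θ = -((-1) ^ N * θ) ∧ (∀ z, s₁ (s₁ z) = z) ∧
        (∀ z : 𝒪[w₁.1.adicCompletion M], s₁ z ∈ 𝒪[w₁.1.adicCompletion M]) ∧ (∀ z, Valued.v (s₁ z) = Valued.v z) := by
    rcases Nat.even_or_odd N with hNe | hNo
    · refine ⟨s'.comp ι', fun x => ?_, ?_, fun z => ?_, fun z => ?_, fun z => ?_⟩
      · rw [RingHom.comp_apply, hι'ι, hs'ι]
      · rw [RingHom.comp_apply, hι'θ, map_neg, hs'θ, hNe.neg_one_pow, one_mul]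
      · rw [RingHom.comp_apply, RingHom.comp_apply, hcomm z, hι'ι', hs's']
      · rw [RingHom.comp_apply]; exact hs'O ⟨ι' z, hι'O z⟩
      · rw [RingHom.comp_apply, hs'v, hι'v]
    · exact ⟨s', hs'ι, by rw [hNo.neg_one_pow, neg_mul, one_mul, neg_neg]; exact hs'θ, hs's', hs'O, hs'v⟩
  have hs₁v' : ∀ z, valuation (w₁.1.adicCompletion M) (s₁ z) = valuation (w₁.1.adicCompletion M) z :=
    fun z => (v_eq_iff_valuation_eq _ _).1 (hs₁v z)
  -- the eigenvalue `λ = (t + yθ)∕2` in `K`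
  letI : Algebra (w.1.adicCompletion L) (w₁.1.adicCompletion M) := (toPlace w.1 w₁).toAlgebra
  have halg : algebraMap (w.1.adicCompletion L) (w₁.1.adicCompletion M) = toPlace w.1 w₁ := RingHom.algebraMap_toAlgebra _
  set lam : w₁.1.adicCompletion M := (toPlace w.1 w₁ t + toPlace w.1 w₁ y * θ) * toPlace w.1 w₁ e₂ with hlam_def
  have hι2 : toPlace w.1 w₁ e₂ * 2 = 1 := by rw [← map_ofNat (toPlace w.1 w₁) 2, ← map_mul, h2e, map_one]
  have hιy : toPlace w.1 w₁ y ≠ 0 := (_root_.map_ne_zero _).2 hy0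
  have hD' : 4 * toPlace w.1 w₁ D = toPlace w.1 w₁ t * toPlace w.1 w₁ t - toPlace w.1 w₁ y * toPlace w.1 w₁ y * toPlace w.1 w₁ (toPlace v w ε₀) := by
    have h := congrArg (toPlace w.1 w₁) hD
    simp only [map_mul, map_sub, map_ofNat] at h
    exact h
  have hquad : lam ^ 2 - toPlace w.1 w₁ t * lam + toPlace w.1 w₁ D = 0 := by
    rw [hlam_def]
    linear_combination (toPlace w.1 w₁ e₂ ^ 2 * (toPlace w.1 w₁ y) ^ 2) * hθ + (toPlace w.1 w₁ e₂ ^ 2) * hD'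
      + (toPlace w.1 w₁ e₂ * toPlace w.1 w₁ t ^ 2 + toPlace w.1 w₁ e₂ * toPlace w.1 w₁ t * (toPlace w.1 w₁ y * θ)
          - toPlace w.1 w₁ D * (2 * toPlace w.1 w₁ e₂ + 1)) * hι2
  have hlam' : lam ^ 2 - algebraMap (w.1.adicCompletion L) (w₁.1.adicCompletion M) t * lam +
      algebraMap (w.1.adicCompletion L) (w₁.1.adicCompletion M) D = 0 := by
    rw [halg]; exact hquad
  have hcoordlam : ∀ z : w₁.1.adicCompletion M, ∃ p q : w.1.adicCompletion L,
      z = algebraMap (w.1.adicCompletion L) (w₁.1.adicCompletion M) p + algebraMap (w.1.adicCompletion L) (w₁.1.adicCompletion M) q * lam := by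
    intro z
    obtain ⟨pq, hpq, -⟩ := hcoord z
    have hyinv : toPlace w.1 w₁ y * (toPlace w.1 w₁ y)⁻¹ = 1 := mul_inv_cancel₀ hιy
    refine ⟨pq.1 - pq.2 * t * y⁻¹, 2 * pq.2 * y⁻¹, ?_⟩
    rw [halg, hpq, hlam_def, map_sub, map_mul, map_mul, map_inv₀, map_mul, map_mul, map_inv₀, map_ofNat]
    linear_combination (-(toPlace w.1 w₁ pq.2 * toPlace w.1 w₁ t * (toPlace w.1 w₁ y)⁻¹) - toPlace w.1 w₁ pq.2 * θ) * hι2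
      + (-(2 * toPlace w.1 w₁ e₂ * toPlace w.1 w₁ pq.2 * θ)) * hyinv
  -- `λ·s̃λ = 1` ((D2-α)-ram §2) and `σu·u = 1`
  have hσu' : u * σw u = 1 := by rw [mul_comm]; exact hσu
  have hlam1 : lam * s₁ lam = 1 :=
    mul_map_mul_eq_one_of_skew_sqrt σw (toPlace w.1 w₁) s₁ hs₁ι hθ hs₁θ hD hσD hσt hσy h2e
  -- `n` is even: `|u² − tu + D|_w = |ι u − λ|²`
  have hneven : Even n := by
    have hlam2 : toPlace w.1 w₁ t - lam = ι' lam := by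
      rw [hlam_def, map_mul, map_add, map_mul, hι'ι, hι'ι, hι'ι, hι'θ]
      linear_combination (-(toPlace w.1 w₁ t)) * hι2
    have hfac : toPlace w.1 w₁ (u * u - t * u + D) = (toPlace w.1 w₁ u - lam) * ι' (toPlace w.1 w₁ u - lam) := by
      rw [map_sub, hι'ι, ← hlam2, map_add, map_sub, map_mul, map_mul]
      linear_combination hquad
    have hV := congrArg Valued.v hfac
    rw [hjv, hn, map_mul, hι'v] at hV
    set V := Valued.v (toPlace w.1 w₁ u - lam) with hVdef
    have hV0 : V ≠ 0 := fun h0 => by rw [h0, mul_zero] at hV; exact WithZero.coe_ne_zero hV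
    rw [← WithZero.exp_log hV0, ← WithZero.exp_add, WithZero.exp_inj] at hV
    exact ⟨(-WithZero.log V).toNat, by omega⟩
  have hNn : 2 ≤ N + n := by obtain ⟨k, hk⟩ := hneven; omega
  -- ★ (D3): the bridge `φ : L_w × K →ₐ M₃(L_w)`
  obtain ⟨φ, hφ, hφx⟩ := exists_algHom_prod u t D lam τ hfτ hK hlam' hirr hχu hcoordlam
  have hσK : ∀ x, s₁ (algebraMap (w.1.adicCompletion L) (w₁.1.adicCompletion M) x) =
      algebraMap (w.1.adicCompletion L) (w₁.1.adicCompletion M) (σw x) := by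
    intro x; rw [halg]; exact hs₁ι x
  have hx1 : ((u, lam) : w.1.adicCompletion L × w₁.1.adicCompletion M) * (σw u, s₁ lam) = 1 :=
    Prod.ext hσu' hlam1
  have hall := exists_aeval_prod_eq u t D lam hχu hcoordlam hlam'
  have hstar := hstar_of_algHom_prod u lam σw s₁ hσK τ (J : Matrix (Fin 3) (Fin 3) (w.1.adicCompletion L)) hτU hτu hx1 hall φ hφx
  -- ★ (D5)-ram at the CM place: the integral order and its index
  obtain ⟨ιO, σO, jO, σ₁O, uO, tO, yO, DO, e₂O, lamO, -, hσOc, hjOc, hσ₁Oc, huO, -, -, -, -, hlamO', hidxA, hidxB⟩ :=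
    exists_integers_relIndex_units_comap_norm_eq_ramifiedCMPlace L w hw he hv2 w₁ hns s₁ hθ hcoord hintK hs₁ι hs₁s₁ hs₁O
      u t D y e₂ hu1 ht2 h2e hD hDv hσu' hlam1 hn hN hN1 hNn
  -- the order `RB = incl R` and `φ(RB) = 𝒪[τ]`
  have hjO' : ∀ x : 𝒪[w.1.adicCompletion L], ((jO x : 𝒪[w₁.1.adicCompletion M]) : w₁.1.adicCompletion M) =
      algebraMap (w.1.adicCompletion L) (w₁.1.adicCompletion M) x := by
    intro x; rw [halg]; exact hjOc x
  have hφx' : φ ((((uO : 𝒪[w.1.adicCompletion L]) : w.1.adicCompletion L), ((lamO : 𝒪[w₁.1.adicCompletion M]) : w₁.1.adicCompletion M)) :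
      w.1.adicCompletion L × w₁.1.adicCompletion M) = τ := by
    rw [huO, hlamO']; exact hφx
  have hRB := mem_adjoin_integer_iff_exists_mem_map jO hjO' uO lamO τ φ hφx'
  refine ⟨fun hex => ?_, fun hex => ?_⟩
  swap
  · -- EMPTY CASE
    have hS : {Λ : Submodule 𝒪[w.1.adicCompletion L] (Fin 3 → w.1.adicCompletion L) |
        (∃ g ∈ unitaryGroupOfForm σw (J : Matrix (Fin 3) (Fin 3) (w.1.adicCompletion L)),
          Λ = Submodule.span 𝒪[w.1.adicCompletion L] (Set.range ((g : Matrix (Fin 3) (Fin 3) (w.1.adicCompletion L)))ᵀ)) ∧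
        ∃ wv : Fin 3 → w.1.adicCompletion L, Λ = Submodule.span 𝒪[w.1.adicCompletion L] (Set.range fun j : Fin 3 => (τ ^ (j : ℕ)) *ᵥ wv)} = ∅ := by
      ext Λ
      simp only [Set.mem_setOf_eq, Set.mem_empty_iff_false, iff_false, not_and]
      rintro ⟨g, hg, hΛg⟩ ⟨wv, hΛw⟩
      exact hex ⟨wv, g, hg, hΛw.symm.trans hΛg⟩
    rw [hS, Set.ncard_empty]
  -- NON-EMPTY CASE: a good unit `b₀` (★ [T2-a] `exists_units_of_mem`), the torsor count (★ [T2-a]-ram), the transport (★ (D3))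
  obtain ⟨wv, g, hg, hwg⟩ := hex
  obtain ⟨b₀, hb₀, -⟩ := exists_units_of_mem σw J τ hK φ hφ ((u, lam) : w.1.adicCompletion L × w₁.1.adicCompletion M) hφx
    (Λ := Submodule.span 𝒪[w.1.adicCompletion L] (Set.range ((g : Matrix (Fin 3) (Fin 3) (w.1.adicCompletion L)))ᵀ)) ⟨⟨g, hg, rfl⟩, wv, hwg.symm⟩
  rw [ncard_setOf_selfDual_cyclic_eq_relIndex_of_ramified (IsCMField.complexConj L) w hc1 hw he h2 J hJ hJh τ hint hK φ hφ
    ((u, lam) : w.1.adicCompletion L × w₁.1.adicCompletion M) hφx (RingHom.prodMap σw s₁) hstar _ hRB b₀ hb₀,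
    relIndex_units_map_prod_eq jO uO lamO σO σw hσOc σ₁O s₁ hσ₁Oc hσv hs₁v']
  rcases Nat.even_or_odd N with hNe | hNo
  · rw [if_neg (Nat.not_odd_iff_even.2 hNe)]
    refine hidxB (by rw [hs₁θ, hNe.neg_one_pow, one_mul]) ?_
    obtain ⟨k, hk⟩ := hneven; obtain ⟨l, hl⟩ := hNe; exact ⟨l + k, by omega⟩
  · rw [if_pos hNo]
    refine hidxA (by rw [hs₁θ, hNo.neg_one_pow, neg_mul, one_mul, neg_neg]) ?_
    obtain ⟨k, hk⟩ := hneven; obtain ⟨l, hl⟩ := hNo; exact ⟨l + k, by omega⟩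

set_option synthInstance.maxHeartbeats 200000 in
set_option maxHeartbeats 1600000 in
/-- **ROW 2 AT ONE RAMIFIED PLACE — THE NUMBER OF SELF-DUAL `τ`-CYCLIC LATTICES OF A DEEP TYPE-(2) UNITARY `τ`.**  For `τ` over the CM completion `E = L_w` at a place
`w ∣ v` RAMIFIED in `L` with `|2|_w = 1` (`J ∈ GL₃(𝒪_w)` `σ_w`-hermitian; `χ_τ = (X − u)(X² − tX + D)` with integral coefficients, `σu·u = 1`, `DσD = 1`, `σt = tσD`, `u ≡ 1`,
`t ≡ 2`, `ord_w(u² − tu + D) = n`, `ord_w(t² − 4D) = 2N` with `1 ≤ N` and `t² − 4D` maximally non-square; a cyclic vector `w₀`):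
`#{Λ : Λ = Λ(g) self-dual (g ∈ U(σ_w,J)) ∧ Λ = ⊕ 𝒪 τ^k w} = 2·q^{(N+n−1)∕2}` (`N` odd) ∕ `(q+1)·q^{(N+n−2)∕2}` (`N` even) if there is such a `Λ`, and `0` otherwise (`q = N(v)`).
The unramified eigen-field `L_w(√(t² − 4D)) = L_w(√ε₀)` ((D2-α)-ram) is realised as the completion of a global `M = L(√m₀)` (★ Q3-unit, ★ QM) and `…_of_model` applies.
[cite: Rogawski1990, §4.9 Lemma 4.9.3 p. 56, Prop. 4.9.1 (b) p. 55] [cite: Kottwitz1986, §3] [cite: Jacobowitz1962, §5, §7] -/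
theorem ncard_selfDual_cyclic_typeTwo_ram_eq (w : PlacesOver L v) (hw : IsCMField.complexConj L • w.1 = w.1)
    (he : v.asIdeal.ramificationIdx' w.1.asIdeal ≠ 1) (hv2 : Valued.v (2 : w.1.adicCompletion L) = 1)
    (J : GL (Fin 3) (w.1.adicCompletion L)) (hJ : J ∈ glInt 3 (w.1.adicCompletion L))
    (hJh : ((J : Matrix (Fin 3) (Fin 3) (w.1.adicCompletion L)).map (galAdicCompletionMap (L := L) (IsCMField.complexConj L) hw))ᵀ = J)
    (τ : Matrix (Fin 3) (Fin 3) (w.1.adicCompletion L))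
    (hτU : (τ.map (galAdicCompletionMap (L := L) (IsCMField.complexConj L) hw))ᵀ * (J : Matrix (Fin 3) (Fin 3) (w.1.adicCompletion L)) * τ = J)
    (hint : ∀ i, τ.charpoly.coeff i ∈ 𝒪[w.1.adicCompletion L])
    {u t D : w.1.adicCompletion L} (hχ : τ.charpoly = (X - C u) * (X ^ 2 - C t * X + C D))
    (hσu : galAdicCompletionMap (L := L) (IsCMField.complexConj L) hw u * u = 1)
    (hσD : D * galAdicCompletionMap (L := L) (IsCMField.complexConj L) hw D = 1)
    (hσt : galAdicCompletionMap (L := L) (IsCMField.complexConj L) hw t = t * galAdicCompletionMap (L := L) (IsCMField.complexConj L) hw D)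
    (hu1 : Valued.v (u - 1) < 1) (ht2 : Valued.v (t - 2) < 1)
    {n N : ℕ} (hn : Valued.v (u * u - t * u + D) = WithZero.exp (-(n : ℤ)))
    (hdisc : Valued.v (t ^ 2 - 4 * D) = WithZero.exp (-((2 * N : ℕ) : ℤ)))
    (hsq : ∀ z : w.1.adicCompletion L, Valued.v (t ^ 2 - 4 * D) ≤ Valued.v (t ^ 2 - 4 * D - z ^ 2)) (hN1 : 1 ≤ N)
    {w₀ : Fin 3 → w.1.adicCompletion L} (hK : IsUnit (Matrix.of fun i j : Fin 3 => ((τ ^ (j : ℕ)) *ᵥ w₀) i).det) :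
    ((∃ wv : Fin 3 → w.1.adicCompletion L, ∃ g ∈ unitaryGroupOfForm (galAdicCompletionMap (L := L) (IsCMField.complexConj L) hw) (J : Matrix (Fin 3) (Fin 3) (w.1.adicCompletion L)),
        Submodule.span 𝒪[w.1.adicCompletion L] (Set.range fun k : Fin 3 => (τ ^ (k : ℕ)) *ᵥ wv) =
          Submodule.span 𝒪[w.1.adicCompletion L] (Set.range ((g : Matrix (Fin 3) (Fin 3) (w.1.adicCompletion L)))ᵀ)) →
      {Λ : Submodule 𝒪[w.1.adicCompletion L] (Fin 3 → w.1.adicCompletion L) |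
          (∃ g ∈ unitaryGroupOfForm (galAdicCompletionMap (L := L) (IsCMField.complexConj L) hw) (J : Matrix (Fin 3) (Fin 3) (w.1.adicCompletion L)),
            Λ = Submodule.span 𝒪[w.1.adicCompletion L] (Set.range ((g : Matrix (Fin 3) (Fin 3) (w.1.adicCompletion L)))ᵀ)) ∧
          ∃ wv : Fin 3 → w.1.adicCompletion L, Λ = Submodule.span 𝒪[w.1.adicCompletion L] (Set.range fun j : Fin 3 => (τ ^ (j : ℕ)) *ᵥ wv)}.ncard =
        if Odd N then 2 * Ideal.absNorm v.asIdeal ^ ((N + n - 1) / 2) else (Ideal.absNorm v.asIdeal + 1) * Ideal.absNorm v.asIdeal ^ ((N + n - 2) / 2)) ∧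
    ((¬ ∃ wv : Fin 3 → w.1.adicCompletion L, ∃ g ∈ unitaryGroupOfForm (galAdicCompletionMap (L := L) (IsCMField.complexConj L) hw) (J : Matrix (Fin 3) (Fin 3) (w.1.adicCompletion L)),
        Submodule.span 𝒪[w.1.adicCompletion L] (Set.range fun k : Fin 3 => (τ ^ (k : ℕ)) *ᵥ wv) =
          Submodule.span 𝒪[w.1.adicCompletion L] (Set.range ((g : Matrix (Fin 3) (Fin 3) (w.1.adicCompletion L)))ᵀ)) →
      {Λ : Submodule 𝒪[w.1.adicCompletion L] (Fin 3 → w.1.adicCompletion L) |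
          (∃ g ∈ unitaryGroupOfForm (galAdicCompletionMap (L := L) (IsCMField.complexConj L) hw) (J : Matrix (Fin 3) (Fin 3) (w.1.adicCompletion L)),
            Λ = Submodule.span 𝒪[w.1.adicCompletion L] (Set.range ((g : Matrix (Fin 3) (Fin 3) (w.1.adicCompletion L)))ᵀ)) ∧
          ∃ wv : Fin 3 → w.1.adicCompletion L, Λ = Submodule.span 𝒪[w.1.adicCompletion L] (Set.range fun j : Fin 3 => (τ ^ (j : ℕ)) *ᵥ wv)}.ncard = 0) := by
  classical
  -- `|D − 1| < 1`: `4(D − 1) = (t − 2)(t + 2) − (t² − 4D)` with `|t² − 4D| = exp(−2N) < 1`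
  have htv : Valued.v t ≤ 1 := by
    have h := Valued.v.map_add_le ht2.le hv2.le
    rwa [sub_add_cancel] at h
  have h4v : Valued.v (4 : w.1.adicCompletion L) = 1 := by
    rw [show (4 : w.1.adicCompletion L) = 2 * 2 by norm_num, map_mul, hv2, mul_one]
  have hD1 : Valued.v (D - 1) < 1 := by
    have h4 : Valued.v (4 * (D - 1)) < 1 := by
      rw [show 4 * (D - 1) = (t - 2) * (t + 2) + -(t ^ 2 - 4 * D) by ring]
      refine (Valued.v.map_add _ _).trans_lt (max_lt ?_ ?_)
      · rw [map_mul]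
        have ht2' : Valued.v (t + 2) ≤ 1 := (Valued.v.map_add _ _).trans (max_le htv hv2.le)
        exact mul_lt_one_of_lt_of_le ht2 ht2'
      · rw [Valuation.map_neg, hdisc, ← WithZero.exp_zero]; exact WithZero.exp_lt_exp.2 (by omega)
    rwa [map_mul, h4v, one_mul] at h4
  -- ★ (D2-α)-ram: `t² − 4D = y²·ι ε₀`, `ε₀` a residue non-square unit of `L⁺_v`, `|y| = exp(−N)`, `σ_w y = (−1)^N·y·σ_w D`
  obtain ⟨y, ε₀, hns, hD, hN, hσy⟩ := exists_skew_sqrt_discriminant_of_ramified L w hw he hv2 hσD hσt hD1 hdisc hsq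
  have hdv : Valued.v (toPlace v w ε₀) = 1 := by
    have h := hns 0 (by rw [map_zero]; exact zero_le_one)
    rwa [zero_mul, zero_sub, Valuation.map_neg] at h
  have hdnsq : ¬ IsSquare (toPlace v w ε₀) := by
    rintro ⟨r, hr⟩
    have hr1 : Valued.v r ≤ 1 := by
      by_contra hlt
      rw [not_le] at hlt
      have h1 : (1 : WithZero (Multiplicative ℤ)) < Valued.v (toPlace v w ε₀) := by
        rw [hr, map_mul]; exact one_lt_mul'' hlt hlt
      exact absurd hdv h1.ne'
    have h := hns r hr1
    rw [← hr, sub_self, map_zero] at h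
    exact zero_ne_one h
  -- ★ Q3-unit: a global `m₀ ∈ 𝓞 L` in the square class of `ι ε₀` at `w`, non-square; ★ QM: `M = L(√m₀)` with its involution
  obtain ⟨m₀, hm₀, hsqm, hnsm⟩ := exists_ringOfIntegers_not_mem_isSquare_inv_mul_not_isSquare (v := w.1) hv2 hdv hdnsq
  have hnsq : ¬ IsSquare ((m₀ : L)) := not_isSquare_of_not_isSquare_algebraMap (m₀ : L) hnsm
  haveI : Fact (Irreducible (X ^ 2 - C ((m₀ : L)) : L[X])) := ⟨irreducible_X_sq_sub_C_of_not_isSquare (m₀ : L) hnsq⟩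
  haveI : NumberField (AdjoinRoot (X ^ 2 - C ((m₀ : L)) : L[X])) := numberField_adjoinRoot (m₀ : L)
  haveI : Algebra.IsQuadraticExtension L (AdjoinRoot (X ^ 2 - C ((m₀ : L)) : L[X])) := isQuadraticExtension_adjoinRoot (m₀ : L)
  obtain ⟨c₁, hc₁, -⟩ := exists_algEquiv_root_eq_neg (m₀ : L)
  have hδ0 : AdjoinRoot.root (X ^ 2 - C ((m₀ : L)) : L[X]) ≠ 0 := root_X_sq_sub_C_ne_zero (m₀ : L)
  have hmδ : algebraMap L (AdjoinRoot (X ^ 2 - C ((m₀ : L)) : L[X])) (m₀ : L) = (AdjoinRoot.root (X ^ 2 - C ((m₀ : L)) : L[X])) ^ 2 :=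
    (root_X_sq_sub_C_sq (m₀ : L)).symm
  obtain ⟨w₁⟩ : Nonempty (PlacesOver (AdjoinRoot (X ^ 2 - C ((m₀ : L)) : L[X])) w.1) := inferInstance
  exact ncard_selfDual_cyclic_typeTwo_ram_eq_of_model L w hw he hv2 J hJ hJh τ hτU hint hχ hσu hσD hσt hu1 ht2 hn hN1 hK hns hD hσy hN
    c₁ hc₁ hδ0 m₀ hmδ hm₀ hsqm w₁

end Literature.NumberTheory.Rogawski1990

end
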